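/-
Copyright (c) 2026 the pub-hodgecm-mathlib formalisation cell (harness21).  Prover seat hodgecm-mathlib-F0P3-p01 (g24); E1 keeper ∕ dealer F0P3a-p03 (g30), E1 BRICK LEDGER
row 59 «K2′∕K4′-UNR ASSEMBLY HEADS» — GLUE F, generic half no. 2 «SS PRESENTATION COUNT» (census `CENSUS-R59-K2K4-UNR.v1` §1 (iii-a)(iii-b)(iii-c)(iii-e)) (2026-09-03).
-/
import Literature.NumberTheory.Automorphic.SchneiderStuhlerTreeComplexGlobal          -- ★ 47d-5a: `exists_reps_univ`, `exists_intertwiningMap_boundary∕augmentation`, `shortExact_univ`, `isSmooth_rep_zeroChains_univ`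
import Literature.NumberTheory.Automorphic.SmoothFixedVectorGeneration               -- ★ row 23: `iSup_fixedPoints_eq_top_of_forall_exists_le`
import Literature.NumberTheory.Automorphic.RestrictedTensorProductIrreducibleProofs  -- ★ `Representation.IsAdmissible.exists_eq_smul_id` (Schur for admissible irreducibles)
import Literature.RepresentationTheory.IntertwiningMapPresentationExtensionSmooth     -- ★ (J′) row 59 GLUE C p853422: `finrank_intertwiningMap_presentation_self_of_isSmooth`
import HarnessLib

/-!
# The Schneider–Stuhler presentation count: `dim Hom_Γ(C₀(X;V), V) = 1 + dim Hom_Γ(C₁(X;V), V)` for an irreducible smooth `V` on a tree whose smooth self-extensions split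
# (Schneider–Stuhler 1997 Thm. II.3.1 + §III.4; Meyer–Solleveld 2010 Thm. 2.4)

Topic `NumberTheory/Automorphic`; namespace `Representation` (next to ★ 5a `SchneiderStuhlerTreeComplexGlobal`, ★ 57-B `SchneiderStuhlerChainsCompactInduction`).  THEOREMS ONLY (no
definition, no instance, no notation, no named fact, no `sorry`); generic over a field `k` of characteristic zero, a topological group `Γ` acting on a TREE `G` (vertices `ι`) by
automorphisms `a` with open vertex stabilisers and an invariant orientation `σ`, a family of compact open vertex groups `U_x` with (U6), (U7) and transport `U_{g·x} = g U_x g⁻¹`,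
and a smooth IRREDUCIBLE representation `ρ` on `V` with a non-zero `U_{x₀}`-fixed vector.  The chain representations `ρ₁`, `ρ₀` on `C₁(X) = ↥(⨆_e [e ↦ V^{U_e}])`,
`C₀(X) = ↥(⨆_x [x ↦ V^{U_x}])` are HYPOTHESIS-STYLE (`hρ₁`, `hρ₀` against the pointwise formulas `hτ₁`, `hτ`), exactly the letters of ★ 5a ∕ ★ 57-B, so that ★ 57-B's Hom-counts
`finrank_intertwiningMap_zeroChains_eq_sum` ∕ `…oneChains_eq_sum` apply to the SAME `ρ₀`, `ρ₁`.

THE MATHEMATICS.  ★ 5a `shortExact_univ`: `0 → C₁(X) —∂→ C₀(X) —ε→ V_X → 0` is exact, `V_X := ⨆_x V^{U_x} ≤ V`.  For `ρ` irreducible with `V^{U_{x₀}} ≠ 0` the transported family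
covers every conjugate of `U_{x₀}`, so `V_X = V` (★ row 23 `iSup_fixedPoints_eq_top_of_forall_exists_le`) and `ε` followed by the inclusion is a surjection `C₀(X) → V` with kernel
`∂(C₁(X))` (§1, «GLUE B» of the census).  `C₀(X)` is smooth (★ 5a).  If every SMOOTH self-extension of `V` splits and `End_Γ(V) = k` (Schur), ★ (J′)
`finrank_intertwiningMap_presentation_self_of_isSmooth` gives **`dim Hom_Γ(C₀(X), V) = 1 + dim Hom_Γ(C₁(X), V)`** — i.e. «`EP(V, V) = Σ_q (−1)^q dim Hom_Γ(C_q(X;V), V) = 1`».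
* §1 `exists_intertwiningMap_presentation_of_isIrreducible` — the presentation `C₁(X) —∂→ C₀(X) —ε→ V` with `∂` injective, `ker ε = range ∂`, `ε` SURJECTIVE onto `V` itself.
* §2 **`finrank_intertwiningMap_zeroChains_eq_one_add_oneChains`** (Schur hypothesis-style `hschur`, any char-0 field) and **`…_of_isAdmissible`** (`k` algebraically closed, `ρ`
  admissible: Schur discharged by ★ `Representation.IsAdmissible.exists_eq_smul_id` at the compact open `U_{x₀}`).
Consumer (cell `pub/hodgecm-mathlib`, crux H413 = `stmt-HodgeConjecture-24833`, E1 row 59 GLUE F «EP-NORM-ONE @ UNR»): with ★ 42 `smoothTrace_epFunction'` and ★ 57-B's two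
Hom-counts this is `tr σ(f_EP^{σ,e}) = 1` (★ `SmoothCharacterEPFunctionTraceOne`), hence `⟨χ_σ, χ_σ⟩_e = 1` by ★ PCT-OUT for the pseudo-coefficient `f_EP^{σ,e}` (row 58) — for
`σ = π²(ξ)` (K2′, `hsplit` ← ★ 40″) and the l.d.s. members (K4′, `hsplit` ← ★ 46″) at an unramified place; NO `L²` ∕ ellipticity antecedent.
UNIVERSES: ★ (J′)'s pushout lives in ONE universe, so the vertex type `ι` and the carrier `V` are taken in the same `Type u` (at the cell's datum both are `Type`).
HONEST LABEL: count-neutral generic base layer; E1 = PRINT until the charter test; h413 OPEN; HC_CM is proved only modulo the printed citations until rung 0 closes.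

## References
* [SchneiderStuhler1997] P. Schneider, U. Stuhler, *Representation theory and sheaves on the Bruhat–Tits building*, Publ. Math. IHÉS 85 (1997): Thm. II.3.1 (exactness of the
  chain complex of `γ_e(V)`), §III.4 (Euler–Poincaré functions, `EP(V, V′)`).
* [MeyerSolleveld2010] R. Meyer, M. Solleveld, *Resolutions for representations of reductive p-adic groups via their buildings*, J. reine angew. Math. 647 (2010): Thm. 2.4.
* [Bump1997] D. Bump, *Automorphic Forms and Representations* (1997): Prop. 4.2.4 (Schur's lemma for admissible irreducibles).
* [Weibel1994] C. A. Weibel, *An Introduction to Homological Algebra* (1994): §3.4 Thm. 3.4.3.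
-/

set_option autoImplicit false

open scoped BigOperators Pointwise
open Function SimpleGraph Literature.NumberTheory.Automorphic Literature.Combinatorics.SimpleGraph Literature.Combinatorics.SimpleGraph.OrientedIncidence
open Literature.RepresentationTheory

namespace Representation

universe u uk uΓ

variable {k : Type uk} [Field k] [CharZero k] {Γ : Type uΓ} [Group Γ] [TopologicalSpace Γ] [IsTopologicalGroup Γ]
  {ι V : Type u} [DecidableEq ι] [AddCommGroup V] [Module k V] {ρ : Representation k Γ V}
  {G : SimpleGraph ι} {a : Γ →* (G ≃g G)}
  {τ : Representation k Γ (ι →₀ V)} (hτ : ∀ (g : Γ) (v : ι →₀ V), τ g v = Finsupp.mapRange (ρ g) (map_zero _) (Finsupp.equivMapDomain (a g).toEquiv v))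
  {τ₁ : Representation k Γ (G.edgeSet →₀ V)}
  (hτ₁ : ∀ (g : Γ) (c : G.edgeSet →₀ V), τ₁ g c = Finsupp.mapRange (ρ g) (map_zero _) (Finsupp.equivMapDomain (a g).mapEdgeSet c))

/-! ## §1 The presentation `0 → C₁(X) → C₀(X) → V → 0` of an irreducible smooth `V` generated by its `U_{x₀}`-fixed vectors -/

include hτ hτ₁ in
/-- **THE SCHNEIDER–STUHLER PRESENTATION OF AN IRREDUCIBLE.**  For a tree with compact open vertex groups (U6)–(U7) transported along the action, `ρ` smooth irreducible with
`V^{U_{x₀}} ≠ 0`, and chain representations `ρ₁`, `ρ₀` (letters `hρ₁`, `hρ₀` of ★ 5a ∕ ★ 57-B): there are intertwining maps `∂ : C₁(X) → C₀(X)`, `ε : C₀(X) → V` with `∂` injective,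
`ker ε = range ∂` and `ε` SURJECTIVE onto `V` — ★ 5a `shortExact_univ` followed by the inclusion `V_X ↪ V`, which is onto because `V_X = ⨆_x V^{U_x} = V` (★ row 23: the family
contains every conjugate `g U_{x₀} g⁻¹ = U_{g·x₀}`, and `ρ` is irreducible). [cite: SchneiderStuhler1997, Thm. II.3.1] [cite: MeyerSolleveld2010, Thm. 2.4] -/
theorem exists_intertwiningMap_presentation_of_isIrreducible (hT : G.IsTree) (σ : Orientation G)
    (hσa : ∀ (g : Γ) (e : G.edgeSet), σ.head ((a g).mapEdgeSet e) = a g (σ.head e) ∧ σ.tail ((a g).mapEdgeSet e) = a g (σ.tail e))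
    (U : ι → Subgroup Γ) (hU : ∀ z, IsCompact (U z : Set Γ))
    (hU6 : ∀ x y, G.Adj x y → ((U x ⊔ U y : Subgroup Γ) : Set Γ) = (U x : Set Γ) * (U y : Set Γ))
    (hU7 : ∀ x y z, G.Adj x y → G.dist y z + 1 = G.dist x z → ((U y : Subgroup Γ) : Set Γ) ⊆ (U x : Set Γ) * (U z : Set Γ))
    (hUa : ∀ (g : Γ) (x : ι), U (a g x) = (U x).map (MulAut.conj g).toMonoidHom)
    (hρ : ρ.IsSmooth) [ρ.IsIrreducible] {x₀ : ι} (hne : ρ.fixedPoints (U x₀) ≠ ⊥)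
    {ρ₁ : Representation k Γ ↥(⨆ e ∈ {e : G.edgeSet | σ.head e ∈ (Set.univ : Set ι) ∧ σ.tail e ∈ (Set.univ : Set ι)},
      (ρ.fixedPoints (U (σ.head e) ⊔ U (σ.tail e))).map (Finsupp.lsingle e : V →ₗ[k] G.edgeSet →₀ V))}
    (hρ₁ : ∀ (g : Γ) c, ((ρ₁ g c : _) : G.edgeSet →₀ V) = τ₁ g c)
    {ρ₀ : Representation k Γ ↥(⨆ x ∈ (Set.univ : Set ι), (ρ.fixedPoints (U x)).map (Finsupp.lsingle x : V →ₗ[k] ι →₀ V))}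
    (hρ₀ : ∀ (g : Γ) v, ((ρ₀ g v : _) : ι →₀ V) = τ g v) :
    ∃ (d : ρ₁.IntertwiningMap ρ₀) (ε : ρ₀.IntertwiningMap ρ),
      Injective d ∧ LinearMap.ker ε.toLinearMap = LinearMap.range d.toLinearMap ∧ Surjective ε := by
  classical
  -- the boundary and augmentation maps and the restricted target `V_X` (★ 41d FILE I∕II, ★ 5a)
  obtain ⟨D, hD⟩ := exists_boundaryMap (k := k) (V := V) σ
  obtain ⟨E, hE⟩ := exists_augmentationMap (k := k) (V := V) (ι := ι)
  have hDC := fun c hc => boundaryMap_mem_zeroChains (ρ := ρ) σ U Set.univ hD (c := c) hc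
  have hEC := fun v hv => augmentationMap_mem_restricted (ρ := ρ) U Set.univ hE (v := v) hv
  obtain ⟨-, -, ρV, -, -, hρV⟩ := exists_reps_univ (ρ := ρ) hτ hτ₁ σ U hUa hσa
  obtain ⟨f, hf⟩ := exists_intertwiningMap_boundary (ρ := ρ) hτ hτ₁ σ U Set.univ hσa hD hDC hρ₁ hρ₀
  obtain ⟨q, hq⟩ := exists_intertwiningMap_augmentation (ρ := ρ) hτ U Set.univ hE hEC hρ₀ hρV
  obtain ⟨hinj, hexact, hsurj⟩ := shortExact_univ (ρ := ρ) hT σ U hU hU6 hU7 hρ hD hE hDC hEC f hf q hq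
  -- «GLUE B»: `V_X = V` for `ρ` irreducible with `V^{U_{x₀}} ≠ 0`
  have htop : (⨆ x ∈ (Set.univ : Set ι), ρ.fixedPoints (U x)) = ⊤ := by
    rw [iSup_univ]
    exact ρ.iSup_fixedPoints_eq_top_of_forall_exists_le (U x₀) U (fun g => ⟨a g x₀, (hUa g x₀).le⟩) hne
  -- the inclusion `V_X ↪ V` as an intertwining map
  have hincl : ∀ (g : Γ) (w : ↥(⨆ x ∈ (Set.univ : Set ι), ρ.fixedPoints (U x))),
      (⨆ x ∈ (Set.univ : Set ι), ρ.fixedPoints (U x)).subtype (ρV g w) = ρ g ((⨆ x ∈ (Set.univ : Set ι), ρ.fixedPoints (U x)).subtype w) :=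
    fun g w => hρV g w
  let incl : ρV.IntertwiningMap ρ := ((⨆ x ∈ (Set.univ : Set ι), ρ.fixedPoints (U x)).subtype).intertwiningMap_of_isIntertwiningMap _ _ hincl
  have hincl_apply : ∀ w, incl w = (w : V) := fun _ => rfl
  refine ⟨f, incl.comp q, hinj, ?_, ?_⟩
  · -- `ker (incl ∘ q) = ker q = range f`
    ext v
    rw [LinearMap.mem_ker, IntertwiningMap.toLinearMap_apply, IntertwiningMap.comp_apply, hincl_apply,
      ZeroMemClass.coe_eq_zero]
    constructor
    · intro hv
      obtain ⟨c, hc⟩ := (hexact v).1 hv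
      exact ⟨c, hc⟩
    · rintro ⟨c, hc⟩
      exact (hexact v).2 ⟨c, hc⟩
  · -- `incl ∘ q` is onto: `q` is onto `V_X` and `V_X = V`
    intro v
    have hv : v ∈ (⨆ x ∈ (Set.univ : Set ι), ρ.fixedPoints (U x)) := by rw [htop]; exact Submodule.mem_top
    obtain ⟨c, hc⟩ := hsurj ⟨v, hv⟩
    exact ⟨c, by rw [IntertwiningMap.comp_apply, hc, hincl_apply]⟩

/-! ## §2 The count `dim Hom_Γ(C₀(X), V) = 1 + dim Hom_Γ(C₁(X), V)` -/

include hτ hτ₁ in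
/-- **THE SCHNEIDER–STUHLER PRESENTATION COUNT** (Schur hypothesis-style).  In the situation of §1 with open vertex stabilisers and open `U_x` (so `C₀(X)` is smooth, ★ 5a), if every
SMOOTH self-extension of `ρ` splits (`hsplit`, ★ (J′)'s letters) and every `Γ`-endomorphism of `ρ` is a scalar (`hschur`), then for `Hom_Γ(C₀(X), V)` finite-dimensional
**`dim_k Hom_Γ(C₀(X), V) = 1 + dim_k Hom_Γ(C₁(X), V)`**  (★ (J′) `finrank_intertwiningMap_presentation_self_of_isSmooth` over §1).  This is «`EP(V,V) = 1`» on the tree.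
[cite: SchneiderStuhler1997, Thm. II.3.1] [cite: SchneiderStuhler1997, §III.4] [cite: Weibel1994, §3.4 Thm. 3.4.3] -/
theorem finrank_intertwiningMap_zeroChains_eq_one_add_oneChains [SeparatelyContinuousMul Γ] (hT : G.IsTree) (σ : Orientation G)
    (hσa : ∀ (g : Γ) (e : G.edgeSet), σ.head ((a g).mapEdgeSet e) = a g (σ.head e) ∧ σ.tail ((a g).mapEdgeSet e) = a g (σ.tail e))
    (hstab : ∀ x : ι, IsOpen {g : Γ | a g x = x})
    (U : ι → Subgroup Γ) (hUo : ∀ x, IsOpen (U x : Set Γ)) (hU : ∀ z, IsCompact (U z : Set Γ))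
    (hU6 : ∀ x y, G.Adj x y → ((U x ⊔ U y : Subgroup Γ) : Set Γ) = (U x : Set Γ) * (U y : Set Γ))
    (hU7 : ∀ x y z, G.Adj x y → G.dist y z + 1 = G.dist x z → ((U y : Subgroup Γ) : Set Γ) ⊆ (U x : Set Γ) * (U z : Set Γ))
    (hUa : ∀ (g : Γ) (x : ι), U (a g x) = (U x).map (MulAut.conj g).toMonoidHom)
    (hρ : ρ.IsSmooth) [ρ.IsIrreducible] {x₀ : ι} (hne : ρ.fixedPoints (U x₀) ≠ ⊥)
    {ρ₁ : Representation k Γ ↥(⨆ e ∈ {e : G.edgeSet | σ.head e ∈ (Set.univ : Set ι) ∧ σ.tail e ∈ (Set.univ : Set ι)},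
      (ρ.fixedPoints (U (σ.head e) ⊔ U (σ.tail e))).map (Finsupp.lsingle e : V →ₗ[k] G.edgeSet →₀ V))}
    (hρ₁ : ∀ (g : Γ) c, ((ρ₁ g c : _) : G.edgeSet →₀ V) = τ₁ g c)
    {ρ₀ : Representation k Γ ↥(⨆ x ∈ (Set.univ : Set ι), (ρ.fixedPoints (U x)).map (Finsupp.lsingle x : V →ₗ[k] ι →₀ V))}
    (hρ₀ : ∀ (g : Γ) v, ((ρ₀ g v : _) : ι →₀ V) = τ g v)
    (hsplit : ∀ (E : Type u) [AddCommGroup E] [Module k E] (ρE : Representation k Γ E), ρE.IsSmooth → ∀ (i : IntertwiningMap ρ ρE) (p : IntertwiningMap ρE ρ),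
      Injective i → LinearMap.ker p.toLinearMap = LinearMap.range i.toLinearMap → Surjective p → ∃ s : IntertwiningMap ρ ρE, p.comp s = IntertwiningMap.id ρ)
    (hschur : ∀ T : IntertwiningMap ρ ρ, ∃ c : k, T.toLinearMap = c • LinearMap.id)
    [FiniteDimensional k (ρ₀.IntertwiningMap ρ)] :
    Module.finrank k (ρ₀.IntertwiningMap ρ) = 1 + Module.finrank k (ρ₁.IntertwiningMap ρ) := by
  haveI : Nontrivial V := IsIrreducible.nontrivial ρ
  obtain ⟨d, ε, hd, hexact, hε⟩ :=
    exists_intertwiningMap_presentation_of_isIrreducible hτ hτ₁ hT σ hσa U hU hU6 hU7 hUa hρ hne hρ₁ hρ₀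
  exact finrank_intertwiningMap_presentation_self_of_isSmooth ρ₁ ρ₀ ρ d ε (isSmooth_rep_zeroChains_univ hτ hstab U hUo Set.univ hρ₀) hρ hd hexact hε hsplit hschur

include hτ hτ₁ in
/-- **THE SCHNEIDER–STUHLER PRESENTATION COUNT for an ADMISSIBLE irreducible over an algebraically closed field**: as above with Schur DISCHARGED — every `Γ`-endomorphism of an
admissible irreducible is a scalar (★ `Representation.IsAdmissible.exists_eq_smul_id` at the compact open `U_{x₀}`). [cite: SchneiderStuhler1997, §III.4] [cite: Bump1997, Proposition 4.2.4] -/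
theorem finrank_intertwiningMap_zeroChains_eq_one_add_oneChains_of_isAdmissible [IsAlgClosed k] [SeparatelyContinuousMul Γ] (hT : G.IsTree) (σ : Orientation G)
    (hσa : ∀ (g : Γ) (e : G.edgeSet), σ.head ((a g).mapEdgeSet e) = a g (σ.head e) ∧ σ.tail ((a g).mapEdgeSet e) = a g (σ.tail e))
    (hstab : ∀ x : ι, IsOpen {g : Γ | a g x = x})
    (U : ι → Subgroup Γ) (hUo : ∀ x, IsOpen (U x : Set Γ)) (hU : ∀ z, IsCompact (U z : Set Γ))
    (hU6 : ∀ x y, G.Adj x y → ((U x ⊔ U y : Subgroup Γ) : Set Γ) = (U x : Set Γ) * (U y : Set Γ))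
    (hU7 : ∀ x y z, G.Adj x y → G.dist y z + 1 = G.dist x z → ((U y : Subgroup Γ) : Set Γ) ⊆ (U x : Set Γ) * (U z : Set Γ))
    (hUa : ∀ (g : Γ) (x : ι), U (a g x) = (U x).map (MulAut.conj g).toMonoidHom)
    (hρ : ρ.IsSmooth) (hadm : ρ.IsAdmissible) [ρ.IsIrreducible] {x₀ : ι} (hne : ρ.fixedPoints (U x₀) ≠ ⊥)
    {ρ₁ : Representation k Γ ↥(⨆ e ∈ {e : G.edgeSet | σ.head e ∈ (Set.univ : Set ι) ∧ σ.tail e ∈ (Set.univ : Set ι)},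
      (ρ.fixedPoints (U (σ.head e) ⊔ U (σ.tail e))).map (Finsupp.lsingle e : V →ₗ[k] G.edgeSet →₀ V))}
    (hρ₁ : ∀ (g : Γ) c, ((ρ₁ g c : _) : G.edgeSet →₀ V) = τ₁ g c)
    {ρ₀ : Representation k Γ ↥(⨆ x ∈ (Set.univ : Set ι), (ρ.fixedPoints (U x)).map (Finsupp.lsingle x : V →ₗ[k] ι →₀ V))}
    (hρ₀ : ∀ (g : Γ) v, ((ρ₀ g v : _) : ι →₀ V) = τ g v)
    (hsplit : ∀ (E : Type u) [AddCommGroup E] [Module k E] (ρE : Representation k Γ E), ρE.IsSmooth → ∀ (i : IntertwiningMap ρ ρE) (p : IntertwiningMap ρE ρ),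
      Injective i → LinearMap.ker p.toLinearMap = LinearMap.range i.toLinearMap → Surjective p → ∃ s : IntertwiningMap ρ ρE, p.comp s = IntertwiningMap.id ρ)
    [FiniteDimensional k (ρ₀.IntertwiningMap ρ)] :
    Module.finrank k (ρ₀.IntertwiningMap ρ) = 1 + Module.finrank k (ρ₁.IntertwiningMap ρ) :=
  finrank_intertwiningMap_zeroChains_eq_one_add_oneChains hτ hτ₁ hT σ hσa hstab U hUo hU hU6 hU7 hUa hρ hne hρ₁ hρ₀ hsplit fun T => by
    obtain ⟨c, hc⟩ := hadm.exists_eq_smul_id (hUo x₀) (hU x₀) T.toLinearMap fun g => LinearMap.ext fun v => IntertwiningMap.isIntertwining _ _ T g v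
    exact ⟨c, hc⟩

end Representation
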